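import Literature.MathematicalPhysics.QuantumFieldTheory.Balaban1983to89.HaarAnalyticZeroSetNullLocalGroups
import Literature.MathematicalPhysics.QuantumFieldTheory.Balaban1983to89.HaarDist1LevelHypersurface
import Literature.MathematicalPhysics.QuantumFieldTheory.Balaban1983to89.HaarExpChartLocalFaceTransport
import Literature.LinearAlgebra.Matrix.UnitaryGramSchmidtRetraction

/-!
# `Balaban1983to89.HaarAnalyticZeroSetNowhereFlat` — THE POINTWISE COMPANION of [BrockerTomDieck1985] IV (2.11) ∕ [Mityagin2015] Prop. 1 on a compact
# group: a real-analytic function with ONE non-zero on a preconnected open piece vanishes on NO neighbourhood of ANY of its points there («nowhere flat»),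
# in the group and in the exponential chart; the operator-norm level function `det((r²−2)·1 + hWk + (hWk)ᴴ)` on `SU(N)` is nowhere flat

statement-level skeleton of published theorems with citation tags; proofs where landed; nothing here is a claim about the Yang–Mills mass gap

Cell `pub-ymgap` (YM-PLAN Track A), node N09 [B12] width seat `pub-ymgap-dag-n09-w3` (g5), `--supports` K1⁹ `StabilityBRunRowsAtRecordR13SepCoPHV` =
stmt-QuantumFields-27364 as a count-neutral helper.  SEQUEL to this seat's `HaarAnalyticZeroSetNullLocal` ∕ `…LocalGroups` (p615186 ∕ p619142: the zero set is
Haar-NULL) and `HaarDist1LevelHypersurface` (p607548: the level function).  LOCATED CONSUMER: the «nowhere fibre-flat» side condition of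
`Literature.MeasureTheory.Integral.AnalyticSubmersion.exists_continuousOn_density_map_of_analytic_submersion_sharp_of_nowhereFibreFlat` (p627574) read through
`nowhereFibreFlat_of_submersiveCoordinates` (this seat's `AnalyticSubmersionNowhereFibreFlat`): its hypothesis `hγ : ∃ᶠ g' → P i x, γ i (M x) g' ≠ 0` for the (2.9)
threshold of [Balaban1987RG1] at a non-distinguished bond `b`, read in the exponential chart at `U₀`, is `∃ᶠ X → A b, det((ε₁²−2)·1 + M(X) + M(X)ᴴ) ≠ 0` with
`M(X) = ↑V^{(j)}(V₀)(b)⁻¹ · ↑Θ(X) · ↑U₀(b)` — §3 below, for every `‖A b‖ < s_C` and every `ε₁ ≠ 0`, with NO hypothesis on `V^{(j)}(V₀)(b)`, `U₀(b)`.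

WHAT IS PROVED (theorems only; 0 def, 0 sorry; axioms standard).
* §1 (generic) `frequently_not_of_measure_zero` (an open-positive measure charging `{p}` with `0` forces `¬p` frequently near every point);
  ★★ `frequently_ne_zero_of_isPreconnected` (p28's setting `h : IsChartRep C ρ`, ANY Haar `μ`: `f` real-analytic on an open `W ⊆ 𝔸`, `S ⊆ G` OPEN preconnected with
  `ρ(S) ⊆ W` and ONE `g₁ ∈ S`, `f(ρ g₁) ≠ 0` ⇒ `∀ g₀ ∈ S, ∃ᶠ g in 𝓝 g₀, f(ρ g) ≠ 0`); ★★ `frequently_ne_zero_expChart_of_isPreconnected` (the same read in the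
  exponential chart: for `‖X₀‖ < s_C` with `k·Θ(X₀) ∈ S`, `∃ᶠ X in 𝓝 X₀, f(ρ(k·Θ X)) ≠ 0` — `Θ⌊B(0,s_C)` is open onto its window: `Λ` continuous, `Λ ∘ Θ = id`).
* §2 (`SU(N)`) `isPreconnected_univ_specialUnitaryGroup` (`SU(N)` is path connected — the tree's `pathConnectedSpace_specialUnitaryGroup`);
  ★★ `specialUnitaryGroup_frequently_ne_zero` (every real-analytic `f : M_N(ℂ) → ℂ` on an open `W ⊇ SU(N)` with one non-zero on `SU(N)` is nowhere flat on `SU(N)`).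
* §3 (the operator-norm level function) ★★★ `frequently_detLevel_conj_ne_zero` (`h k : SU(N)`, `r ≠ 0`: `∀ W₀, ∃ᶠ W in 𝓝 W₀, det((r²−2)·1 + ↑h↑W↑k + (↑h↑W↑k)ᴴ) ≠ 0` —
  witness `W = h⁻¹k⁻¹`), ★★★ `frequently_detLevel_conj_expChart_ne_zero` (chart form at every `‖X₀‖ < s_C`), `frequently_normSq_detLevel_conj_expChart_ne_zero`
  (the real-valued `Complex.normSq` form = the `γ` of `nowhereFibreFlat_of_submersiveCoordinates`).

HONEST SCOPE.  (i) Generic measure theory ∕ topology BY NAME over p28's charts and this seat's g4 files; nothing of p28 ∕ Mathlib re-proved.  (ii) No claim about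
Bałaban's renormalization group: that the (2.9) threshold in road B's chart IS this level function of `Θ(A b)` and that the chart-read averaging with the bond
coordinate is a joint submersion are the consumer's inputs (dag-n09-w2 ∕ w4 lanes); `hreg`∕`contTOn` stay displayed; N09 is NOT discharged; nothing continuum ∕ OS ∕
mass gap ∕ Clay.
-/

noncomputable section

open NormedSpace Set Function Filter Topology MeasureTheory
open scoped ENNReal NNReal Matrix.Norms.L2Operator

namespace Literature.MathematicalPhysics.QuantumFieldTheory.Balaban1983to89.HaarAnalyticZeroSetNowhereFlat

open HaarExponentialChart HaarExponentialChart.IsChartRep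
open HaarAnalyticZeroSetNullLocal (haar_zeroSet_eq_zero_of_isPreconnected)
open HaarAnalyticZeroSetNullLocalGroups (specialUnitaryGroup_haar_zeroSet_eq_zero_of_isPreconnected)
open HaarDist1LevelHypersurface (analyticOnNhd_det_level_comp det_level_one_ne_zero level_const_add_two_ne_zero)

/-! ## §1 Generic: null zero sets of an open-positive measure are nowhere dense-in-measure; the group and the chart forms -/

section Generic

/-- **An open-positive measure giving measure `0` to `{x | p x}` forces `¬ p` FREQUENTLY near every point** (else an open neighbourhood of positive measure would
lie in the null set). [cite: BrockerTomDieck1985, IV (2.11) (proof; bookkeeping)] -/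
theorem frequently_not_of_measure_zero {X : Type*} [TopologicalSpace X] [MeasurableSpace X] {μ : Measure X} [μ.IsOpenPosMeasure]
    {p : X → Prop} (hp : μ {x | p x} = 0) (x₀ : X) : ∃ᶠ x in 𝓝 x₀, ¬ p x := by
  by_contra hcon
  rw [Filter.not_frequently] at hcon
  simp only [not_not] at hcon
  obtain ⟨U, hUsub, hUo, hx₀U⟩ := _root_.eventually_nhds_iff.1 hcon
  have hpos : 0 < μ U := hUo.measure_pos μ ⟨x₀, hx₀U⟩
  have hle : μ U ≤ μ {x | p x} := measure_mono fun x hx => hUsub x hx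
  exact absurd (hp ▸ hle) (not_le.2 hpos)

variable {𝔸 : Type*} [NormedRing 𝔸] [NormedAlgebra ℂ 𝔸] [CompleteSpace 𝔸]
variable {G : Type*} [Group G] [TopologicalSpace G] [IsTopologicalGroup G] [CompactSpace G] [MeasurableSpace G] [BorelSpace G]
variable {C : LogChart 𝔸} {ρ : G →* 𝔸} [FiniteDimensional ℝ C.lie]
variable {W : Set 𝔸} {f : 𝔸 → ℂ}

/-- ★★ **NOWHERE FLAT ON A PRECONNECTED OPEN PIECE WITH ONE NON-ZERO** (the pointwise companion of `haar_zeroSet_eq_zero_of_isPreconnected`): for `f` real-analytic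
on an open `W`, `S ⊆ G` open and preconnected with `ρ(S) ⊆ W` and one `g₁ ∈ S` with `f(ρ g₁) ≠ 0`, the zero set of `f ∘ ρ` contains NO neighbourhood of any point of
`S`. (Haar measure is open-positive; the zero set in `S` is Haar-null.) [cite: BrockerTomDieck1985, IV (2.11) (proof)] [cite: Mityagin2015, Proposition 1] -/
theorem frequently_ne_zero_of_isPreconnected (μ : Measure G) [μ.IsHaarMeasure] (h : IsChartRep C ρ)
    (hlie : ∀ x ∈ C.lie, ∀ y ∈ C.lie, x * y - y * x ∈ C.lie)
    (hW : IsOpen W) (hf : AnalyticOnNhd ℝ f W) {S : Set G} (hSo : IsOpen S) (hS : IsPreconnected S) (hSW : ∀ g ∈ S, ρ g ∈ W)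
    (hne : ∃ g₁ ∈ S, f (ρ g₁) ≠ 0) : ∀ g₀ ∈ S, ∃ᶠ g in 𝓝 g₀, f (ρ g) ≠ 0 := by
  intro g₀ hg₀
  have hnull : μ {g ∈ S | f (ρ g) = 0} = 0 :=
    haar_zeroSet_eq_zero_of_isPreconnected μ h hlie hW hf hS hSW hne
  have hfreq := frequently_not_of_measure_zero (p := fun g => g ∈ S ∧ f (ρ g) = 0) hnull g₀
  have hS𝓝 : ∀ᶠ g in 𝓝 g₀, g ∈ S := hSo.mem_nhds hg₀
  refine (hfreq.and_eventually hS𝓝).mono fun g hg => ?_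
  exact fun h0 => hg.1 ⟨hg.2, h0⟩

/-- ★★ **… READ IN THE EXPONENTIAL CHART**: under the same hypotheses, for `‖X₀‖ < s_C` with `Θ(X₀) ∈ S`: `∃ᶠ X in 𝓝 X₀, f(ρ(Θ X)) ≠ 0` — the chart `Θ`
restricted to the chart ball is OPEN onto its window (`Λ` is a continuous left inverse there, dag-n09-w2's `continuousOn_logChart`), so a chart-neighbourhood of
`X₀` on which `f ∘ ρ ∘ Θ` vanished would give a group-neighbourhood of `Θ(X₀)` on which `f ∘ ρ` vanished.
[cite: Helgason2000, Ch. I §1 Thm. 1.14 (13) p. 96] [cite: Mityagin2015, Proposition 1] -/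
theorem frequently_ne_zero_expChart_of_isPreconnected (μ : Measure G) [μ.IsHaarMeasure] (h : IsChartRep C ρ)
    (hlie : ∀ x ∈ C.lie, ∀ y ∈ C.lie, x * y - y * x ∈ C.lie)
    (hW : IsOpen W) (hf : AnalyticOnNhd ℝ f W) {S : Set G} (hSo : IsOpen S) (hS : IsPreconnected S) (hSW : ∀ g ∈ S, ρ g ∈ W)
    (hne : ∃ g₁ ∈ S, f (ρ g₁) ≠ 0) {X₀ : C.lie} (hX₀ : ‖X₀‖ < chartRadius C) (hX₀S : h.expChart X₀ ∈ S) :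
    ∃ᶠ X in 𝓝 X₀, f (ρ (h.expChart X)) ≠ 0 := by
  have hgrp := frequently_ne_zero_of_isPreconnected μ h hlie hW hf hSo hS hSW hne _ hX₀S
  set g₀ : G := h.expChart X₀ with hg₀
  -- the continuous left inverse `Λ` near `g₀ = Θ X₀`
  have hwin : ‖ρ g₀ - 1‖ < innerRadius C := by
    rw [hg₀, h.rho_expChart]
    exact norm_exp_sub_one_lt (C := C) hX₀ le_rfl
  have hopen : IsOpen {g : G | ‖ρ g - 1‖ < innerRadius C} :=
    isOpen_lt (continuous_norm.comp (h.continuous.sub continuous_const)) continuous_const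
  have hΛ : ContinuousAt h.logChart g₀ := (h.continuousOn_logChart _ hwin).continuousAt (hopen.mem_nhds hwin)
  have hΛg₀ : h.logChart g₀ = X₀ := by rw [hg₀]; exact h.logChart_expChart hX₀
  -- transport: if `f ∘ ρ ∘ Θ` vanished near `X₀`, then `f ∘ ρ` would vanish near `g₀`
  by_contra hcon
  rw [Filter.not_frequently] at hcon
  simp only [not_not] at hcon
  have hT : Tendsto h.logChart (𝓝 g₀) (𝓝 X₀) := by
    have := hΛ.tendsto; rwa [hΛg₀] at this
  have hev : ∀ᶠ g in 𝓝 g₀, f (ρ (h.expChart (h.logChart g))) = 0 := hT.eventually hcon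
  have hwinev : ∀ᶠ g in 𝓝 g₀, ‖ρ g - 1‖ < innerRadius C := hopen.mem_nhds hwin
  apply hgrp
  filter_upwards [hev, hwinev] with g hg hgw
  rw [h.expChart_logChart hgw] at hg
  exact fun hne' => hne' hg

end Generic

/-! ## §2 `SU(N)`: connectedness, nowhere-flatness of analytic functions with one non-zero -/

section SpecialUnitary

variable {N : ℕ} [NeZero N]

/-- `SU(N)` is preconnected (path connected: the tree's `pathConnectedSpace_specialUnitaryGroup`). [cite: BrockerTomDieck1985, I (1.10) (SU(n) connected)] -/
theorem isPreconnected_univ_specialUnitaryGroup : IsPreconnected (univ : Set (Matrix.specialUnitaryGroup (Fin N) ℂ)) := by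
  obtain ⟨k, hk⟩ := Nat.exists_eq_succ_of_ne_zero (NeZero.ne N)
  subst hk
  haveI : PathConnectedSpace (Matrix.specialUnitaryGroup (Fin (k + 1)) ℂ) :=
    Literature.LinearAlgebra.Matrix.pathConnectedSpace_specialUnitaryGroup
  exact isPreconnected_univ

/-- ★★ **ON `SU(N)` AN ANALYTIC FUNCTION WITH ONE NON-ZERO IS NOWHERE FLAT**: `f : M_N(ℂ) → ℂ` real-analytic on an open `W ⊇ SU(N)` with `f(↑g₁) ≠ 0` for some
`g₁ ∈ SU(N)` ⇒ `∀ W₀, ∃ᶠ W in 𝓝 W₀, f(↑W) ≠ 0`. [cite: BrockerTomDieck1985, IV (2.11) (proof)] [cite: Mityagin2015, Proposition 1] -/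
theorem specialUnitaryGroup_frequently_ne_zero {W : Set (Matrix (Fin N) (Fin N) ℂ)} (hW : IsOpen W)
    (hSW : ∀ g : Matrix.specialUnitaryGroup (Fin N) ℂ, (g : Matrix (Fin N) (Fin N) ℂ) ∈ W) {f : Matrix (Fin N) (Fin N) ℂ → ℂ}
    (hf : AnalyticOnNhd ℝ f W) (hne : ∃ g₁ : Matrix.specialUnitaryGroup (Fin N) ℂ, f (g₁ : Matrix (Fin N) (Fin N) ℂ) ≠ 0)
    (W₀ : Matrix.specialUnitaryGroup (Fin N) ℂ) :
    ∃ᶠ W in 𝓝 W₀, f ((W : Matrix.specialUnitaryGroup (Fin N) ℂ) : Matrix (Fin N) (Fin N) ℂ) ≠ 0 := by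
  haveI : (HaarData.haar : Measure (Matrix.specialUnitaryGroup (Fin N) ℂ)).IsHaarMeasure := Measure.isHaarMeasure_haarMeasure _
  have hnull : (HaarData.haar : Measure (Matrix.specialUnitaryGroup (Fin N) ℂ))
      {g ∈ (univ : Set (Matrix.specialUnitaryGroup (Fin N) ℂ)) | f (g : Matrix (Fin N) (Fin N) ℂ) = 0} = 0 :=
    specialUnitaryGroup_haar_zeroSet_eq_zero_of_isPreconnected HaarData.haar hW hf isPreconnected_univ_specialUnitaryGroup
      (fun g _ => hSW g) (by obtain ⟨g₁, hg₁⟩ := hne; exact ⟨g₁, mem_univ _, hg₁⟩)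
  have hnull' : (HaarData.haar : Measure (Matrix.specialUnitaryGroup (Fin N) ℂ))
      {g | f (g : Matrix (Fin N) (Fin N) ℂ) = 0} = 0 := by
    refine measure_mono_null (fun g hg => ?_) hnull
    exact ⟨mem_univ _, hg⟩
  exact frequently_not_of_measure_zero (p := fun g : Matrix.specialUnitaryGroup (Fin N) ℂ => f (g : Matrix (Fin N) (Fin N) ℂ) = 0) hnull' W₀

end SpecialUnitary

/-! ## §3 The operator-norm level function `det((r² − 2)·1 + hWk + (hWk)ᴴ)` is nowhere flat on `SU(N)` and in the chart -/

section DetLevel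

variable {N : ℕ} [NeZero N]

omit [NeZero N] in
/-- The conjugated letter `W ↦ A · W · B` is real-analytic on `M_N(ℂ)`. [cite: HornJohnson2013, §0.2 (matrix products; bookkeeping)] -/
theorem analyticOnNhd_const_mul_mul_const (A B : Matrix (Fin N) (Fin N) ℂ) :
    AnalyticOnNhd ℝ (fun M : Matrix (Fin N) (Fin N) ℂ => A * M * B) univ := fun _ _ =>
  (analyticAt_const.mul analyticAt_id).mul analyticAt_const

/-- ★★★ **THE LEVEL FUNCTION IS NOWHERE FLAT ON `SU(N)`**: for `h k : SU(N)` and `r ≠ 0`, at EVERY `W₀ ∈ SU(N)`: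
`∃ᶠ W in 𝓝 W₀, det((r² − 2)·1 + ↑h↑W↑k + (↑h↑W↑k)ᴴ) ≠ 0` — the function is real-analytic on `M_N(ℂ)`, equals `(r²)^N ≠ 0` at `W = h⁻¹k⁻¹`, and `SU(N)` is connected.
In particular the threshold set `{‖↑h↑W↑k − 1‖ = r}` (inside the zero set, p607548) contains no open subset of `SU(N)`. [cite: Balaban1985Averaging, (19) p.21]
[cite: BrockerTomDieck1985, IV (2.11) (proof)] [cite: Mityagin2015, Proposition 1] -/
theorem frequently_detLevel_conj_ne_zero (h k : Matrix.specialUnitaryGroup (Fin N) ℂ) {r : ℝ} (hr : r ≠ 0) (W₀ : Matrix.specialUnitaryGroup (Fin N) ℂ) :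
    ∃ᶠ W in 𝓝 W₀, ((((r ^ 2 - 2 : ℝ) : ℂ)) • (1 : Matrix (Fin N) (Fin N) ℂ) +
      ((h : Matrix (Fin N) (Fin N) ℂ) * ((W : Matrix.specialUnitaryGroup (Fin N) ℂ) : Matrix (Fin N) (Fin N) ℂ) *
        (k : Matrix (Fin N) (Fin N) ℂ)) +
      ((h : Matrix (Fin N) (Fin N) ℂ) * ((W : Matrix.specialUnitaryGroup (Fin N) ℂ) : Matrix (Fin N) (Fin N) ℂ) *
        (k : Matrix (Fin N) (Fin N) ℂ)).conjTranspose).det ≠ 0 := by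
  have hf := analyticOnNhd_det_level_comp (analyticOnNhd_const_mul_mul_const (N := N) (h : Matrix (Fin N) (Fin N) ℂ) (k : Matrix (Fin N) (Fin N) ℂ))
    (((r ^ 2 - 2 : ℝ) : ℂ))
  refine specialUnitaryGroup_frequently_ne_zero isOpen_univ (fun _ => mem_univ _) hf ⟨h⁻¹ * k⁻¹, ?_⟩ W₀
  have h1 : (h : Matrix (Fin N) (Fin N) ℂ) * ((h⁻¹ * k⁻¹ : Matrix.specialUnitaryGroup (Fin N) ℂ) : Matrix (Fin N) (Fin N) ℂ) *
      (k : Matrix (Fin N) (Fin N) ℂ) = 1 := by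
    rw [← Submonoid.coe_mul, ← Submonoid.coe_mul, ← mul_assoc, mul_inv_cancel, one_mul, inv_mul_cancel]
    rfl
  show ((((r ^ 2 - 2 : ℝ) : ℂ)) • (1 : Matrix (Fin N) (Fin N) ℂ) + _ + _).det ≠ 0
  rw [h1]
  exact det_level_one_ne_zero (level_const_add_two_ne_zero hr)

/-- ★★★ **… AND IN THE EXPONENTIAL CHART OF `SU(N)`** (p28's `isChartRep_specialUnitaryGroup`, `Θ` its chart, `s_C` its radius): for `‖X₀‖ < s_C`,
`∃ᶠ X in 𝓝 X₀, det((r² − 2)·1 + ↑h↑Θ(X)↑k + (↑h↑Θ(X)↑k)ᴴ) ≠ 0` — the `γ`-input of `nowhereFibreFlat_of_submersiveCoordinates` for the (2.9) threshold read in road B's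
chart (`h = V^{(j)}(V₀)(b)⁻¹`, `k = U₀(b)`, `r = ε₁`), with NO hypothesis on `h`, `k`. [cite: Balaban1987RG1, (2.9) p.266 and (2.10) p.267]
[cite: Helgason2000, Ch. I §1 Thm. 1.14 (13) p. 96] [cite: Mityagin2015, Proposition 1] -/
theorem frequently_detLevel_conj_expChart_ne_zero (h k : Matrix.specialUnitaryGroup (Fin N) ℂ) {r : ℝ} (hr : r ≠ 0)
    {X₀ : (specialUnitaryLogChart (Fin N)).lie} (hX₀ : ‖X₀‖ < chartRadius (specialUnitaryLogChart (Fin N))) :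
    ∃ᶠ X in 𝓝 X₀, ((((r ^ 2 - 2 : ℝ) : ℂ)) • (1 : Matrix (Fin N) (Fin N) ℂ) +
      ((h : Matrix (Fin N) (Fin N) ℂ) * ((isChartRep_specialUnitaryGroup (n := Fin N)).expChart X : Matrix (Fin N) (Fin N) ℂ) *
        (k : Matrix (Fin N) (Fin N) ℂ)) +
      ((h : Matrix (Fin N) (Fin N) ℂ) * ((isChartRep_specialUnitaryGroup (n := Fin N)).expChart X : Matrix (Fin N) (Fin N) ℂ) *
        (k : Matrix (Fin N) (Fin N) ℂ)).conjTranspose).det ≠ 0 := by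
  have hf := analyticOnNhd_det_level_comp (analyticOnNhd_const_mul_mul_const (N := N) (h : Matrix (Fin N) (Fin N) ℂ) (k : Matrix (Fin N) (Fin N) ℂ))
    (((r ^ 2 - 2 : ℝ) : ℂ))
  have hne : ∃ g₁ ∈ (univ : Set (Matrix.specialUnitaryGroup (Fin N) ℂ)),
      (fun W : Matrix (Fin N) (Fin N) ℂ => ((((r ^ 2 - 2 : ℝ) : ℂ)) • (1 : Matrix (Fin N) (Fin N) ℂ) +
        ((h : Matrix (Fin N) (Fin N) ℂ) * W * (k : Matrix (Fin N) (Fin N) ℂ)) +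
        ((h : Matrix (Fin N) (Fin N) ℂ) * W * (k : Matrix (Fin N) (Fin N) ℂ)).conjTranspose).det)
        ((g₁ : Matrix.specialUnitaryGroup (Fin N) ℂ) : Matrix (Fin N) (Fin N) ℂ) ≠ 0 := by
    refine ⟨h⁻¹ * k⁻¹, mem_univ _, ?_⟩
    have h1 : (h : Matrix (Fin N) (Fin N) ℂ) * ((h⁻¹ * k⁻¹ : Matrix.specialUnitaryGroup (Fin N) ℂ) : Matrix (Fin N) (Fin N) ℂ) *
        (k : Matrix (Fin N) (Fin N) ℂ) = 1 := by
      rw [← Submonoid.coe_mul, ← Submonoid.coe_mul, ← mul_assoc, mul_inv_cancel, one_mul, inv_mul_cancel]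
      rfl
    show ((((r ^ 2 - 2 : ℝ) : ℂ)) • (1 : Matrix (Fin N) (Fin N) ℂ) + _ + _).det ≠ 0
    rw [h1]
    exact det_level_one_ne_zero (level_const_add_two_ne_zero hr)
  haveI : (HaarData.haar : Measure (Matrix.specialUnitaryGroup (Fin N) ℂ)).IsHaarMeasure := Measure.isHaarMeasure_haarMeasure _
  have key := frequently_ne_zero_expChart_of_isPreconnected (HaarData.haar : Measure (Matrix.specialUnitaryGroup (Fin N) ℂ))
    (isChartRep_specialUnitaryGroup (n := Fin N))
    (lie_adStable_specialUnitaryGroup (n := Fin N)) isOpen_univ hf isOpen_univ isPreconnected_univ_specialUnitaryGroup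
    (fun _ _ => mem_univ _) hne hX₀ (mem_univ _)
  exact key.mono fun X hX => hX

/-- The real-valued form through `Complex.normSq` (same zero set): `∃ᶠ X in 𝓝 X₀, normSq(det(…Θ(X)…)) ≠ 0` — literally the `γ` of the flat-locus engine's
coordinate criterion. [cite: Balaban1987RG1, (2.9) p.266 and (2.10) p.267] [cite: Mityagin2015, Proposition 1] -/
theorem frequently_normSq_detLevel_conj_expChart_ne_zero (h k : Matrix.specialUnitaryGroup (Fin N) ℂ) {r : ℝ} (hr : r ≠ 0)
    {X₀ : (specialUnitaryLogChart (Fin N)).lie} (hX₀ : ‖X₀‖ < chartRadius (specialUnitaryLogChart (Fin N))) :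
    ∃ᶠ X in 𝓝 X₀, Complex.normSq ((((r ^ 2 - 2 : ℝ) : ℂ)) • (1 : Matrix (Fin N) (Fin N) ℂ) +
      ((h : Matrix (Fin N) (Fin N) ℂ) * ((isChartRep_specialUnitaryGroup (n := Fin N)).expChart X : Matrix (Fin N) (Fin N) ℂ) *
        (k : Matrix (Fin N) (Fin N) ℂ)) +
      ((h : Matrix (Fin N) (Fin N) ℂ) * ((isChartRep_specialUnitaryGroup (n := Fin N)).expChart X : Matrix (Fin N) (Fin N) ℂ) *
        (k : Matrix (Fin N) (Fin N) ℂ)).conjTranspose).det ≠ 0 :=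
  (frequently_detLevel_conj_expChart_ne_zero h k hr hX₀).mono fun _ hX => by rwa [Ne, Complex.normSq_eq_zero]

end DetLevel

end Literature.MathematicalPhysics.QuantumFieldTheory.Balaban1983to89.HaarAnalyticZeroSetNowhereFlat

end
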